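import Summits.RiemannHypothesis.RiemannHypothesis.Theorems.Splittings.RobinFiniteStairCA
import HarnessLib

/-!
# RobinFiniteStairCert — g18 «THE WHOLE STAIRCASE», part 2/9

CA side: the pure-`ℕ` staircase certificate format (`sigPow`, `entryOK`, `blockOK`, `stairOK`, `eL`, `NL`; 2-adic logarithm certificates)
and its soundness `staircase_le_log : θP + θQ + (θR + (log 2/100)·NL) ≤ log N`.

Cell rh-split, seat rh-split-robin-finite g18 (brief sha16 f79c5f09d8bcb036), card `cards/SPLIT-robin-finite.md` §25; carved VERBATIM from the
kernel-checked object `HOME/rh-split-robin-finite/g18/SketchG18.lean` (sha16 923f3031290138f6; `lean check` rc 0, 0 warnings, 0 sorries).  Zero `instance`,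
zero `notation`, no attribute changes, no `native_decide` in this file; no `def … : Prop`; every conjecture / print fact appears only as an explicit
hypothesis (`Buthe2016_thm2`, `Buthe2018_thm2_theta`, `BroadbentEtAl2021_theta_rel_1e19`, `RiemannHypothesisUpTo T`).

THE LINE.  A colossally abundant `N = ∏ p^{a_p}` with largest prime `P` and structure prime `Q` (largest prime of exponent `≥ 2`) satisfies not
only `log N ≥ θ(P) + θ(Q)` (the tree) but `log N ≥ θ(P) + θ(Q) + Λ` with `Λ = Σ_{j≥3} θ(x_j)` the higher storeys of the Alaoglu–Erdős staircase;
`Λ_K` is certified per dyadic piece `2^K ≤ P < 2^{K+1}` and spent on the analytic side as EXTRA zero-tail budget `d_k` on top of the tree's level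
budgets `b_k` (`E_b` is affine in `b`; the gain `G₁^Λ − G₁` pays `d_k·w(P)`), so the SAME verified height `T` certifies a LONGER range of CA primes.

HONEST LABEL: «SPLITTING SEARCH over kernel-typed RH-EQUIVALENCES; a splitting A ∧ B ⟹ RH is CONDITIONAL bookkeeping unless A and B
are both proved; nothing here bears on the truth of RH.»
-/

set_option linter.dupNamespace false

noncomputable section

open Real Finset
open scoped ArithmeticFunction.sigma Chebyshev

namespace Summit.RiemannHypothesis.RiemannHypothesis.Theorems.Splittings.RobinFiniteC1

section StaircaseCert

open Nat
variable {ε : ℝ} {N : ℕ}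

/-! ### The certificate format -/

/-- `σ(p^m) = 1 + p + … + p^m` as a structural recursion (kernel-friendly). -/
def sigPow (p : ℕ) : ℕ → ℕ
  | 0 => 1
  | m + 1 => p * sigPow p m + 1

/-- `sigPow p m = σ(p^m)` for prime `p` (the recursion `σ(p^{m+1}) = p·σ(p^m) + 1`). -/
theorem sigPow_eq {p : ℕ} (hp : p.Prime) (m : ℕ) : sigPow p m = σ 1 (p ^ m) := by
  induction m with
  | zero => simp [sigPow]
  | succ m ih => rw [sigPow, ih, sigma_one_prime_pow_succ hp]

/-- One list entry `(p, e, ν, ν')`: `0 < e`, `p^100 ≤ 2^ν`, `2^ν' ≤ p^100`, and the storey test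
`σ(p^{2+b+e})·ν ≤ 100·K·2^K` with `b = [p ≤ R]`. -/
def entryOK (K R : ℕ) (q : ℕ × ℕ × ℕ × ℕ) : Bool :=
  decide (0 < q.2.1) && decide (q.1 ^ 100 ≤ 2 ^ q.2.2.1) && decide (2 ^ q.2.2.2 ≤ q.1 ^ 100) &&
    decide (sigPow q.1 (2 + (if q.1 ≤ R then 1 else 0) + q.2.1) * q.2.2.1 ≤ 100 * K * 2 ^ K)

/-- The block test at `R` (every prime `p ≤ R` then has `a_p ≥ 3`): `R ≤ 2^K`, `R^100 ≤ 2^νR`,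
`(1 + R + R² + R³)·νR ≤ 100·K·2^K` (vacuous for `R = 0`). -/
def blockOK (K R nuR : ℕ) : Bool :=
  decide (R ≤ 2 ^ K) && decide (R ^ 100 ≤ 2 ^ nuR) && decide (sigPow R 3 * nuR ≤ 100 * K * 2 ^ K)

/-- The whole certificate: block test, every entry, keys `≤ 2^K` and pairwise distinct. -/
def stairOK (K R nuR : ℕ) (L : List (ℕ × ℕ × ℕ × ℕ)) : Bool :=
  blockOK K R nuR && L.all (entryOK K R) && L.all (fun q => decide (q.1 ≤ 2 ^ K)) &&
    decide ((L.map Prod.fst).Nodup)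

/-- The certified storey increments: `eL L p = Σ_{(p', e, …) ∈ L, p' = p} e`. -/
def eL (L : List (ℕ × ℕ × ℕ × ℕ)) (p : ℕ) : ℕ := (L.map fun q => if q.1 = p then q.2.1 else 0).sum

/-- `NL L = Σ e·ν'` — `(log 2/100)·NL` is the certified value of `Σ e·log p`. -/
def NL (L : List (ℕ × ℕ × ℕ × ℕ)) : ℕ := (L.map fun q => q.2.1 * q.2.2.2).sum

/-- unfolding `eL` on a cons cell. -/
theorem eL_cons (q : ℕ × ℕ × ℕ × ℕ) (L : List (ℕ × ℕ × ℕ × ℕ)) (p : ℕ) :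
    eL (q :: L) p = (if q.1 = p then q.2.1 else 0) + eL L p := by
  simp [eL]

/-- a prime absent from the certificate gets certified exponent `0`. -/
theorem eL_eq_zero_of_forall_ne {L : List (ℕ × ℕ × ℕ × ℕ)} {p : ℕ} (h : ∀ q ∈ L, q.1 ≠ p) : eL L p = 0 := by
  induction L with
  | nil => simp [eL]
  | cons q L ih =>
    rw [eL_cons, if_neg (h q (by simp)), ih (fun q' hq' => h q' (by simp [hq']))]

/-- with distinct primes, the certified exponent of an entry's prime is that entry's exponent. -/
theorem eL_eq_of_mem {L : List (ℕ × ℕ × ℕ × ℕ)} (hnd : (L.map Prod.fst).Nodup) {q : ℕ × ℕ × ℕ × ℕ} (hq : q ∈ L) :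
    eL L q.1 = q.2.1 := by
  induction L with
  | nil => simp at hq
  | cons q' L ih =>
    rw [List.map_cons, List.nodup_cons] at hnd
    rcases List.mem_cons.1 hq with rfl | hq
    · rw [eL_cons, if_pos rfl, eL_eq_zero_of_forall_ne, add_zero]
      intro q'' hq'' he
      exact hnd.1 (by rw [← he]; exact List.mem_map.2 ⟨q'', hq'', rfl⟩)
    · have hne : q'.1 ≠ q.1 := fun he => hnd.1 (by rw [he]; exact List.mem_map.2 ⟨q, hq, rfl⟩)
      rw [eL_cons, if_neg hne, zero_add, ih hnd.2 hq]

/-- `x ↦ x log x` is monotone on `[1, ∞)`: `2^K·log 2^K ≤ P log P` for `2^K ≤ P`. -/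
theorem pow_mul_log_le {K P : ℕ} (hKP : 2 ^ K ≤ P) :
    (2 : ℝ) ^ K * Real.log ((2 : ℝ) ^ K) ≤ P * Real.log P := by
  have h1 : (1 : ℝ) ≤ (2 : ℝ) ^ K := one_le_pow₀ (by norm_num)
  have h2 : ((2 : ℝ) ^ K) ≤ P := by exact_mod_cast hKP
  have h3 : Real.log ((2 : ℝ) ^ K) ≤ Real.log P := Real.log_le_log (by positivity) h2
  have h4 : 0 ≤ Real.log ((2 : ℝ) ^ K) := Real.log_nonneg h1
  exact mul_le_mul h2 h3 h4 (by positivity)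

/-- From a 2-adic certificate `p^100 ≤ 2^ν`: `log p ≤ (ν/100)·log 2`. -/
theorem log_le_of_cert {p ν : ℕ} (hp : 0 < p) (h : p ^ 100 ≤ 2 ^ ν) :
    Real.log p ≤ (ν : ℝ) / 100 * Real.log 2 := by
  have h1 : ((p : ℝ) ^ 100) ≤ (2 : ℝ) ^ ν := by exact_mod_cast h
  have h2 := Real.log_le_log (by positivity) h1
  rw [Real.log_pow, Real.log_pow] at h2
  push_cast at h2
  linarith

/-- From `2^ν' ≤ p^100`: `(ν'/100)·log 2 ≤ log p`. -/
theorem le_log_of_cert {p ν : ℕ} (h : 2 ^ ν ≤ p ^ 100) :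
    (ν : ℝ) / 100 * Real.log 2 ≤ Real.log p := by
  have h1 : (2 : ℝ) ^ ν ≤ ((p : ℝ) ^ 100) := by exact_mod_cast h
  have h2 := Real.log_le_log (by positivity) h1
  rw [Real.log_pow, Real.log_pow] at h2
  push_cast at h2
  linarith

/-- Soundness of the storey test in certificate form: `σ(p^m)·ν ≤ 100 K 2^K` and `p^100 ≤ 2^ν` give
`σ(p^m) log p ≤ 2^K log 2^K ≤ P log P`, hence `m ≤ a_p`. -/
theorem le_factorization_of_cert (h : IsCAParameter ε N) (hε : 0 < ε) (hN : N ≠ 0) {P K p m ν : ℕ}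
    (hP : P.Prime) (hPN : P ∣ N) (hKP : 2 ^ K ≤ P) (hp : p.Prime) (hν : p ^ 100 ≤ 2 ^ ν)
    (hm : sigPow p m * ν ≤ 100 * K * 2 ^ K) : m ≤ N.factorization p := by
  refine le_factorization_of_sigma_mul_log_le h hε hN hP hPN hp ?_
  have h1 := log_le_of_cert hp.pos hν
  have h2 : ((σ 1 (p ^ m) : ℕ) : ℝ) * ν ≤ 100 * K * 2 ^ K := by
    rw [← sigPow_eq hp]; exact_mod_cast hm
  have hσ0 : (0 : ℝ) ≤ (σ 1 (p ^ m) : ℕ) := by positivity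
  have hl2 : 0 < Real.log 2 := Real.log_pos (by norm_num)
  calc ((σ 1 (p ^ m) : ℕ) : ℝ) * Real.log p ≤ (σ 1 (p ^ m) : ℕ) * ((ν : ℝ) / 100 * Real.log 2) :=
        mul_le_mul_of_nonneg_left h1 hσ0
    _ = ((σ 1 (p ^ m) : ℕ) * ν : ℝ) / 100 * Real.log 2 := by ring
    _ ≤ (100 * K * 2 ^ K : ℝ) / 100 * Real.log 2 := by gcongr
    _ = (2 : ℝ) ^ K * Real.log ((2 : ℝ) ^ K) := by rw [Real.log_pow]; ring
    _ ≤ P * Real.log P := pow_mul_log_le hKP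

/-- **Soundness of the staircase certificate.**  For a number `N` with parameter `ε > 0`, largest prime `P ≥ 2^K`,
structure prime `Q` (every prime `≤ Q` has exponent `≥ 2`) and a certificate `stairOK K R νR L` whose keys are prime:
`θ(P) + θ(Q) + θ(R) + (log 2/100)·NL(L) ≤ log N`.  (Pointwise: `a_p ≥ 1 + [p ≤ Q] + [p ≤ R] + e_L(p)`.) -/
theorem staircase_le_log (h : IsCAParameter ε N) (hε : 0 < ε) (hN : N ≠ 0) {P Q K R νR : ℕ}
    {L : List (ℕ × ℕ × ℕ × ℕ)} (hP : P.Prime) (hPN : P ∣ N) (hpf : N.primeFactors = primesLE P)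
    (hQP : Q ≤ P) (h2 : ∀ p ∈ primesLE Q, 2 ≤ N.factorization p) (hKP : 2 ^ K ≤ P)
    (hc : stairOK K R νR L = true) (hprime : ∀ q ∈ L, q.1.Prime) :
    θ P + θ Q + (θ R + Real.log 2 / 100 * (NL L : ℝ)) ≤ Real.log N := by
  classical
  simp only [stairOK, blockOK, Bool.and_eq_true, decide_eq_true_eq, List.all_eq_true] at hc
  obtain ⟨⟨⟨⟨⟨hR2K, hRν⟩, hRσ⟩, hent⟩, hkeys⟩, hnd⟩ := hc
  have hRP : R ≤ P := hR2K.trans hKP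
  have hl2 : 0 < Real.log 2 := Real.log_pos (by norm_num)
  -- pointwise exponent bound `β p := [p ≤ R] + eL L p`, `a_p ≥ 2 + β p` when `β p > 0`
  have hβ : ∀ p ∈ primesLE P, 0 < (if p ≤ R then 1 else 0) + eL L p →
      2 + ((if p ≤ R then 1 else 0) + eL L p) ≤ N.factorization p := by
    intro p hp hpos
    have hp' := Nat.prime_of_mem_primesLE hp
    -- the list part
    by_cases hmem : ∃ q ∈ L, q.1 = p
    · obtain ⟨q, hq, rfl⟩ := hmem
      have he := eL_eq_of_mem hnd hq
      have hq' := hent q hq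
      simp only [entryOK, Bool.and_eq_true, decide_eq_true_eq] at hq'
      obtain ⟨⟨⟨-, hν⟩, -⟩, hσ⟩ := hq'
      rw [he]
      have := le_factorization_of_cert h hε hN hP hPN hKP hp' hν hσ
      simpa [add_assoc] using this
    · push Not at hmem
      have he : eL L p = 0 := eL_eq_zero_of_forall_ne hmem
      rw [he, add_zero] at hpos ⊢
      by_cases hpR : p ≤ R
      · rw [if_pos hpR]
        -- block: `σ(p^3) ν_R ≤ σ(R^3) ν_R ≤ 100 K 2^K`, `p^100 ≤ R^100 ≤ 2^νR`
        have hν : p ^ 100 ≤ 2 ^ νR := le_trans (Nat.pow_le_pow_left hpR 100) hRν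
        have hmono : sigPow p 3 ≤ sigPow R 3 := by
          simp only [sigPow]
          have := hpR
          gcongr
        exact le_factorization_of_cert h hε hN hP hPN hKP hp' hν
          (le_trans (Nat.mul_le_mul_right _ hmono) hRσ)
      · rw [if_neg hpR] at hpos; exact absurd hpos (lt_irrefl 0)
  -- sum it up
  rw [log_eq_sum_factorization_mul_log hN, hpf, Chebyshev.theta_eq_sum_primesLE_log P,
    Chebyshev.theta_eq_sum_primesLE_log Q, Chebyshev.theta_eq_sum_primesLE_log R]
  have hfil : ∀ {S : ℕ}, S ≤ P → (primesLE P).filter (fun p => p ≤ S) = primesLE S := by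
    intro S hSP
    ext p
    simp only [Finset.mem_filter, Nat.mem_primesLE]
    constructor
    · rintro ⟨⟨-, hp⟩, hpS⟩
      exact ⟨hpS, hp⟩
    · rintro ⟨hpS, hp⟩
      exact ⟨⟨hpS.trans hSP, hp⟩, hpS⟩
  have key : ∑ p ∈ primesLE P, (Real.log p + (if p ≤ Q then Real.log p else 0) +
      ((if p ≤ R then Real.log p else 0) + (eL L p : ℝ) * Real.log p)) ≤
      ∑ p ∈ primesLE P, (N.factorization p : ℝ) * Real.log p := by
    refine Finset.sum_le_sum fun p hp => ?_
    have hp' := Nat.prime_of_mem_primesLE hp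
    have hlogp : 0 ≤ Real.log p := Real.log_nonneg (by exact_mod_cast hp'.one_lt.le)
    have hpN : p ∣ N := Nat.dvd_of_mem_primeFactors (hpf ▸ hp)
    have ha1 : (1 : ℝ) ≤ N.factorization p := by exact_mod_cast hp'.factorization_pos_of_dvd hN hpN
    by_cases hpos : 0 < (if p ≤ R then 1 else 0) + eL L p
    · have hb := hβ p hp hpos
      have hb' : (2 : ℝ) + (((if p ≤ R then 1 else 0 : ℕ) : ℝ) + (eL L p : ℝ)) ≤ N.factorization p := by
        exact_mod_cast hb
      have e1 : ((if p ≤ R then Real.log p else 0) : ℝ) = (((if p ≤ R then 1 else 0 : ℕ) : ℝ)) * Real.log p := by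
        split_ifs <;> simp
      have e2 : ((if p ≤ Q then Real.log p else 0) : ℝ) ≤ Real.log p := by
        split_ifs <;> linarith
      rw [e1]
      nlinarith
    · have hz : (if p ≤ R then 1 else 0) + eL L p = 0 := by omega
      have hR0 : ¬ p ≤ R := by
        intro hpR; rw [if_pos hpR] at hz; omega
      have he0 : eL L p = 0 := by rw [if_neg hR0] at hz; simpa using hz
      rw [if_neg hR0, he0]
      push_cast
      simp only [zero_mul, add_zero]
      split_ifs with hpQ
      · have : (2 : ℝ) ≤ N.factorization p := by exact_mod_cast h2 p (Nat.mem_primesLE.2 ⟨hpQ, hp'⟩)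
        nlinarith
      · nlinarith
  rw [Finset.sum_add_distrib, Finset.sum_add_distrib, Finset.sum_add_distrib, ← Finset.sum_filter,
    ← Finset.sum_filter, hfil hQP, hfil hRP] at key
  -- the list sum: `(log 2/100)·NL ≤ Σ_p eL p log p`
  have hlist : Real.log 2 / 100 * (NL L : ℝ) ≤ ∑ p ∈ primesLE P, (eL L p : ℝ) * Real.log p := by
    -- by induction over `L` (keys distinct primes `≤ P`)
    suffices hsuff : ∀ L' : List (ℕ × ℕ × ℕ × ℕ), (∀ q ∈ L', q ∈ L) → (L'.map Prod.fst).Nodup →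
        Real.log 2 / 100 * (NL L' : ℝ) ≤ ∑ p ∈ primesLE P, (eL L' p : ℝ) * Real.log p from
      hsuff L (fun q hq => hq) hnd
    intro L' hsub hnd'
    induction L' with
    | nil => simp [NL, eL]
    | cons q L' ih =>
      rw [List.map_cons, List.nodup_cons] at hnd'
      have hqL : q ∈ L := hsub q (by simp)
      have ih' := ih (fun q' hq' => hsub q' (by simp [hq'])) hnd'.2
      have hq' := hent q hqL
      simp only [entryOK, Bool.and_eq_true, decide_eq_true_eq] at hq'
      obtain ⟨⟨⟨-, -⟩, hν'⟩, -⟩ := hq'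
      have hqp := hprime q hqL
      have hqP : q.1 ∈ primesLE P := Nat.mem_primesLE.2 ⟨(hkeys q hqL).trans hKP, hqp⟩
      have hNL : (NL (q :: L') : ℝ) = (q.2.1 : ℝ) * q.2.2.2 + NL L' := by
        simp [NL]
      have hsum : ∑ p ∈ primesLE P, (eL (q :: L') p : ℝ) * Real.log p =
          (q.2.1 : ℝ) * Real.log q.1 + ∑ p ∈ primesLE P, (eL L' p : ℝ) * Real.log p := by
        simp only [eL_cons, Nat.cast_add, add_mul, Finset.sum_add_distrib]
        congr 1
        rw [Finset.sum_eq_single q.1]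
        · simp
        · intro p _ hne
          rw [if_neg (Ne.symm hne)]; simp
        · intro hn; exact absurd hqP hn
      rw [hNL, hsum]
      have hlow := le_log_of_cert hν'
      have he0 : (0 : ℝ) ≤ q.2.1 := by positivity
      have : Real.log 2 / 100 * ((q.2.1 : ℝ) * q.2.2.2) ≤ (q.2.1 : ℝ) * Real.log q.1 := by
        have := mul_le_mul_of_nonneg_left hlow he0
        linarith [this]
      linarith
  linarith

end StaircaseCert

end Summit.RiemannHypothesis.RiemannHypothesis.Theorems.Splittings.RobinFiniteC1

end
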